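import Literature.NumberTheory.Automorphic.PicardCMUniverse
import Literature.AlgebraicGeometry.HodgeTheory.TopDegreeClasses
import Literature.AlgebraicGeometry.Motives.SubschemeCycles
import HarnessLib

/-!
# COR-CM model layer (model-2): sections of the binary product (`Fact_prodSection`) on the
# Picard–CM model universe

Cell `pub-hodgecm2` (COR-CM), seat `model-2`; input of row Fg2 of `BINDER-OWNERS.md`.  The stage-1 package
derives the §1c fact F2 = M35 `Universe.Fact_factorActDescends` from `ModelAxioms` + N1 + N3 + ONE further
class-M fact (`HodgeCM/Proofs/Pohlmann/FactorActDescent.lean`, `Universe.fact_factorActDescends_of_prodSection`):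

  `Universe.Fact_prodSection`: for all `X Y : U.Var`, the projections of `X × Y` have sections —
  `∃ s : X → X × Y, s ; pr_X = id_X` and `∃ s' : Y → X × Y, s' ; pr_Y = id_Y`.

Here we PROVE that fact for the model of record (tree objects `PicardCM.Var`, `Var.scheme hU h₃`, morphisms of
`SchemeOver ℂ = Over (Spec ℂ)` with its cartesian monoidal structure): every variety of the universe is smooth
projective, hence `X(ℂ)` is connected and in particular NON-EMPTY (`connectedSpace_complexPoints`); a complex
point `y₀ : Spec ℂ → Y` gives the constant morphism `X → Spec ℂ → Y` and the section `s = (id_X, y₀)` by the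
universal property of the fibre product (`CartesianMonoidalCategory.lift`, `lift_fst`).
[Hartshorne, *Algebraic Geometry* II §3, Thm. 3.3; Görtz–Wedhorn I, Def. 4.10 / Thm. 4.18, Cor. 3.36]

The statements `var_prodSection_fst/snd` and `var_prodSection` are, by `rfl` on the fields
`Mor/prod/comp/fst/snd/idMor` of `Model.universeOf hHD hI hU h₃` (`CorCM/Model/Universe.lean`), literally the two
halves and the body of `(Model.universeOf hHD hI hU h₃).Fact_prodSection`; the one-line junction lands with that
file.
-/

noncomputable section

open CategoryTheory MonoidalCategory CartesianMonoidalCategory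
open Literature.AlgebraicGeometry.Motives (SchemeOver ComplexPoints IsSmoothProjective specOver toSpecOver)
open Literature.AlgebraicGeometry.HodgeTheory
open Literature.NumberTheory.Automorphic.PicardCM

namespace Summit.HodgeConjecture.CorCM.Model

/-! ### Scheme level: sections of `X ⊗ Y → X` from a complex point of `Y` -/

/-- **Section of the first projection**: for `y₀ ∈ Y(ℂ)`, `s = (id_X, y₀) : X → X ⊗ Y` — with `y₀` the
constant morphism `X → Spec ℂ → Y` (`toSpecOver X ≫ y₀`) — satisfies `s ; fst = id_X` (universal property of the
fibre product over `Spec ℂ`). [folklore] -/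
theorem exists_section_fst_of_point (X : SchemeOver ℂ) {Y : SchemeOver ℂ} (y₀ : ComplexPoints Y) :
    ∃ s : X ⟶ X ⊗ Y, s ≫ fst X Y = 𝟙 X :=
  ⟨lift (𝟙 X) (toSpecOver X ≫ y₀), lift_fst _ _⟩

/-- **Section of the second projection**: for `x₀ ∈ X(ℂ)`, `s' = (x₀, id_Y) : Y → X ⊗ Y` satisfies
`s' ; snd = id_Y`. [folklore] -/
theorem exists_section_snd_of_point {X : SchemeOver ℂ} (x₀ : ComplexPoints X) (Y : SchemeOver ℂ) :
    ∃ s' : Y ⟶ X ⊗ Y, s' ≫ snd X Y = 𝟙 Y :=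
  ⟨lift (toSpecOver Y ≫ x₀) (𝟙 Y), lift_snd _ _⟩

/-! ### The model of record: every `PicardCM.Var` -/

/-- Every variety of the Picard–CM universe has a complex point (`X(ℂ)` is connected, in particular
non-empty: `connectedSpace_complexPoints`). [folklore] -/
theorem var_nonempty_complexPoints (hU : BallQuotientUniformisedDatum) (h₃ : CMAbelianVarietyRealised) (v : Var) :
    Nonempty (ComplexPoints (Var.scheme hU h₃ v)) :=
  (connectedSpace_complexPoints (Var.isSmoothProjective hU h₃ v)).toNonempty

/-- **First half of `Fact_prodSection` on the model**: `pr_X : X × Y → X` has a section, for all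
varieties `X, Y` of the Picard–CM universe. [folklore] -/
theorem var_prodSection_fst (hU : BallQuotientUniformisedDatum) (h₃ : CMAbelianVarietyRealised) (v w : Var) :
    ∃ s : Var.Mor hU h₃ v (.prod v w), Var.comp hU h₃ s (Var.fst hU h₃ v w) = Var.idMor hU h₃ v := by
  obtain ⟨y₀⟩ := var_nonempty_complexPoints hU h₃ w
  exact exists_section_fst_of_point (Var.scheme hU h₃ v) y₀

/-- **Second half of `Fact_prodSection` on the model**: `pr_Y : X × Y → Y` has a section. [folklore] -/
theorem var_prodSection_snd (hU : BallQuotientUniformisedDatum) (h₃ : CMAbelianVarietyRealised) (v w : Var) :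
    ∃ s' : Var.Mor hU h₃ w (.prod v w), Var.comp hU h₃ s' (Var.snd hU h₃ v w) = Var.idMor hU h₃ w := by
  obtain ⟨x₀⟩ := var_nonempty_complexPoints hU h₃ v
  exact exists_section_snd_of_point x₀ (Var.scheme hU h₃ w)

/-- **`Fact_prodSection` on the model of record** (the body of
`(Model.universeOf hHD hI hU h₃).Fact_prodSection`, by `rfl` on the universe's fields): both projections of
every binary product of the Picard–CM universe have sections. [folklore] -/
theorem var_prodSection (hU : BallQuotientUniformisedDatum) (h₃ : CMAbelianVarietyRealised) : ∀ v w : Var,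
    (∃ s : Var.Mor hU h₃ v (.prod v w), Var.comp hU h₃ s (Var.fst hU h₃ v w) = Var.idMor hU h₃ v) ∧
      (∃ s' : Var.Mor hU h₃ w (.prod v w), Var.comp hU h₃ s' (Var.snd hU h₃ v w) = Var.idMor hU h₃ w) :=
  fun v w ↦ ⟨var_prodSection_fst hU h₃ v w, var_prodSection_snd hU h₃ v w⟩

end Summit.HodgeConjecture.CorCM.Model
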